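import Literature.Analysis.FluidPDE.UlocSmallDataMild
import Literature.Analysis.FluidPDE.KatoLocalLerayPressureProofs
import Literature.Analysis.FluidPDE.MildL3SmoothHolds
import Literature.Analysis.FluidPDE.KNSSSmoothingHolds
import Literature.Analysis.FluidPDE.KatoLerayHopf
import Literature.Analysis.FluidPDE.JiaSverak2014RegularFlow
import Literature.Analysis.FluidPDE.JiaSverak2014SlabAprioriEstimate
import Literature.Analysis.FluidPDE.NSSereginMildCore
import Literature.Analysis.FluidPDE.ClassicalSuitable
import Literature.Analysis.FluidPDE.SuitableWeakCongr
import Literature.Analysis.FluidPDE.NSBoundedMildSmoothing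
import Literature.Analysis.FluidPDE.LocalEnergySolutionsOn
import Literature.Analysis.FluidPDE.EnstrophySplitting
import HarnessLib

/-!
# The regular flow from a bounded datum small in `L³_uloc` (Lemarié-Rieusset 2016, Thm. 14.8,
# proof, Step 2: the small solution `α₁`)

Analysis/FluidPDE theorem file (no definitions, no named facts). The uniformly local small-data
mild solution of `UlocSmallDataMild.lean` (`exists_isKatoSolutionOn_uloc_small`: the Kato solution
`u` on `[0, 4)` from a bounded, weakly divergence-free datum `α ∈ L²∩L³` with
`sup_z ‖α‖_{L³(B(z,1))} ≤ ε ≤ ε₀`) is packaged as the **regular flow** consumed by the perturbed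
energy inequality (`PerturbedEnergySlice/WholeSpace/Gronwall.lean`) and by the limiting
procedure of the local energy theory:

* its classical representative `(a, π)` on `(0, 4)` (`mild_L3_smooth_holds`), with `a(t) = u(t)`
  for `0 < t < 4` (both are continuous: `u` solves Oseen's integral equation pointwise, so KNSS's
  smoothing `knss2009_smoothing_holds` applies to `u` itself);
* `(a, p_K)` a local Leray solution on `(0, 2)` with datum `α` and a pressure **globally** in
  `L^{3/2}((0,2) × ℝ³)` (the Riesz pressure of `kato_distributional_slab_holds`,
  `IsKatoSolutionOn.exists_suitable_slab_of_distributional`);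
* the bounds `|a| ≤ M`, `√t |∇a| ≤ C` (KNSS, depending on the datum), the energy bound
  `∫|a(t)|² ≤ 2E(α)` (`u` is Leray–Hopf, `IsKatoSolutionOn.isLerayHopfOn_of_memLp_two`), and the
  **uniform** bounds `‖a(t)‖_{L³(B(z,1))} ≤ Kε`, `|a(t,x)| ≤ Kε t^{-1/2}`;
* the **uniform local gradient bound** `∫₀²∫_{B(x₀,1)} |∇a|² ≤ C_g` with `C_g` depending on `ε₀`
  only: Jia–Šverák's a priori estimate at unit scale (`JiaSverak2014.apriori_unit_scale_slab`)
  applied on short windows `(s, s + τ)` to the restarted Kato solutions `u(s + ·)`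
  (`IsKatoSolutionOn.restart`, `kato_isLocalLeraySolutionOn_holds`), whose data have unit-ball
  energies `≤ |B₁|^{1/3} (Kε)²` by Hölder, finitely many windows covering `(0, 2)`.

## References

* P. G. Lemarié-Rieusset, *The Navier–Stokes Problem in the 21st Century* (2016), Thm. 14.8,
  proof, Step 2 (PDF pp. 521–525); Thm. 15.1 (A).
* H. Jia, V. Šverák, Invent. Math. 196 (2014), Lemma 3.1; SIAM J. Math. Anal. 45 (2013), Lemma 2.
* H. Koch, N. Nadirashvili, G. Seregin, V. Šverák, Acta Math. 203 (2009), Prop. 4.1.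
-/

noncomputable section

open MeasureTheory TopologicalSpace Set Function Filter Metric
open _root_.Topology
open scoped ENNReal NNReal RealInnerProductSpace ContDiff

namespace Literature.Analysis.FluidPDE

open JiaSverak2014

/-! ### Tools -/

/-- `∫_{B(x₀,1)} |f|² ≤ |B₁|^{1/3} ‖f‖²_{L³(B(x₀,1))}` (Hölder on the unit ball). [folklore] -/
theorem lintegral_unitBall_sq_le_eLpNorm_three_ball
    {f : EuclideanSpace ℝ (Fin 3) → EuclideanSpace ℝ (Fin 3)} (hf : AEStronglyMeasurable f volume)
    (x₀ : EuclideanSpace ℝ (Fin 3)) :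
    ∫⁻ x in ball x₀ 1, ‖f x‖ₑ ^ 2 ≤
      volume (ball (0 : EuclideanSpace ℝ (Fin 3)) 1) ^ (1 / 3 : ℝ) *
        eLpNorm f 3 (volume.restrict (ball x₀ 1)) ^ 2 := by
  set μB : Measure (EuclideanSpace ℝ (Fin 3)) := volume.restrict (ball x₀ 1) with hμB
  have hm : AEStronglyMeasurable f μB := hf.restrict
  have h1 : eLpNorm f 2 μB ≤ eLpNorm f 3 μB * μB univ ^ (1 / (2 : ℝ≥0∞).toReal - 1 / (3 : ℝ≥0∞).toReal) :=
    eLpNorm_le_eLpNorm_mul_rpow_measure_univ (by norm_num) hm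
  have hr : (1 / (2 : ℝ≥0∞).toReal - 1 / (3 : ℝ≥0∞).toReal : ℝ) = 1 / 6 := by
    rw [ENNReal.toReal_ofNat, ENNReal.toReal_ofNat]; norm_num
  have hμ : μB univ = volume (ball (0 : EuclideanSpace ℝ (Fin 3)) 1) := by
    rw [hμB, Measure.restrict_apply_univ]
    exact Measure.addHaar_ball_center volume x₀ 1
  rw [hr, hμ] at h1
  calc ∫⁻ x in ball x₀ 1, ‖f x‖ₑ ^ 2 = eLpNorm f 2 μB ^ 2 := lintegral_enorm_sq_eq_eLpNorm_two_sq μB f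
    _ ≤ (eLpNorm f 3 μB * volume (ball (0 : EuclideanSpace ℝ (Fin 3)) 1) ^ (1 / 6 : ℝ)) ^ 2 :=
        pow_le_pow_left' h1 2
    _ = volume (ball (0 : EuclideanSpace ℝ (Fin 3)) 1) ^ (1 / 3 : ℝ) * eLpNorm f 3 μB ^ 2 := by
        rw [mul_pow, ← ENNReal.rpow_natCast (volume _ ^ (1 / 6 : ℝ)) 2, ← ENNReal.rpow_mul, mul_comm]
        norm_num

/-- **Translation in time of a space–time integral**:
`∫∫_{(s,s+τ)×B} F = ∫∫_{(0,τ)×B} F(s + t, x)` (Lebesgue measure is translation invariant).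
[folklore] -/
theorem setLIntegral_prod_comp_add_left {X : Type*} [MeasurableSpace X] {μ : Measure X} [SFinite μ]
    (s τ : ℝ) (B : Set X) (F : ℝ × X → ℝ≥0∞) :
    ∫⁻ z in Ioo s (s + τ) ×ˢ B, F z ∂((volume : Measure ℝ).prod μ) =
      ∫⁻ z in Ioo 0 τ ×ˢ B, F (s + z.1, z.2) ∂((volume : Measure ℝ).prod μ) := by
  have hmp : MeasurePreserving (Prod.map (fun t : ℝ => s + t) id) ((volume : Measure ℝ).prod μ)
      ((volume : Measure ℝ).prod μ) :=
    (measurePreserving_add_left volume s).prod (MeasurePreserving.id μ)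
  have hemb : MeasurableEmbedding (Prod.map (fun t : ℝ => s + t) id) :=
    (MeasurableEquiv.prodCongr (MeasurableEquiv.addLeft s) (MeasurableEquiv.refl X)).measurableEmbedding
  have hpre : (Prod.map (fun t : ℝ => s + t) id) ⁻¹' (Ioo s (s + τ) ×ˢ B) = Ioo 0 τ ×ˢ B := by
    ext z
    simp only [mem_preimage, Prod.map_fst, Prod.map_snd, id_eq, mem_prod, mem_Ioo]
    constructor
    · rintro ⟨⟨h1, h2⟩, h3⟩; exact ⟨⟨by linarith, by linarith⟩, h3⟩
    · rintro ⟨⟨h1, h2⟩, h3⟩; exact ⟨⟨by linarith, by linarith⟩, h3⟩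
  rw [← hmp.setLIntegral_comp_preimage_emb hemb F (Ioo s (s + τ) ×ˢ B), hpre]
  rfl

/-- **The windows cover the strip**: for `τ > 0` and `N = ⌈4/τ⌉₊`,
`(0, 2) ⊆ ⋃_{m ≤ N} (mτ/2, mτ/2 + τ)`. [folklore] -/
theorem Ioo_subset_biUnion_windows {τ : ℝ} (hτ : 0 < τ) :
    Ioo (0 : ℝ) 2 ⊆ ⋃ m ∈ Finset.range (⌈4 / τ⌉₊ + 1), Ioo ((m : ℝ) * τ / 2) ((m : ℝ) * τ / 2 + τ) := by
  intro t ht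
  rw [mem_iUnion₂]
  -- `m = ⌈2t/τ⌉₊ - 1`
  have h2t : 0 < 2 * t / τ := by have := ht.1; positivity
  set n : ℕ := ⌈2 * t / τ⌉₊ with hn
  have hn1 : 1 ≤ n := Nat.one_le_ceil_iff.2 h2t
  have hnle : (n : ℝ) - 1 < 2 * t / τ := by
    have := Nat.ceil_lt_add_one h2t.le
    rw [← hn] at this; linarith
  have hnge : 2 * t / τ ≤ n := Nat.le_ceil _
  refine ⟨n - 1, ?_, ?_⟩
  · rw [Finset.mem_range]
    have hnN : n ≤ ⌈4 / τ⌉₊ := by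
      refine Nat.ceil_mono ?_
      exact div_le_div_of_nonneg_right (by linarith [ht.2]) hτ.le
    omega
  · have hcast : ((n - 1 : ℕ) : ℝ) = (n : ℝ) - 1 := by
      rw [Nat.cast_sub hn1, Nat.cast_one]
    rw [mem_Ioo, hcast]
    constructor
    · -- `(n-1) τ/2 < t`
      have h := mul_lt_mul_of_pos_right hnle hτ
      rw [div_mul_cancel₀ _ hτ.ne'] at h
      linarith
    · -- `t ≤ n τ/2 < (n-1)τ/2 + τ`
      have h := mul_le_mul_of_nonneg_right hnge hτ.le
      rw [div_mul_cancel₀ _ hτ.ne'] at h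
      linarith

/-- For a Leray–Hopf solution with `f = 0`, `∫ |u(t)|² ≤ 2E(u₀)` on `[0,T]` (energy inequality from
`0`, dropping the dissipation) — DEPRECATED duplicate of `IsLerayHopfOn.lintegral_enorm_sq_le`
(`TaoLocalisation.lean`, which is in this module's import closure anyway; librarian dedup 2026-08-16,
work item dedup-01261); kept under its old name as a one-line alias proof (never deleted), no longer
used in this file. [cite: Leray1934, (5.2)] -/
@[deprecated IsLerayHopfOn.lintegral_enorm_sq_le (since := "2026-08-16")]
theorem IsLerayHopfOn.lintegral_enorm_sq_le_energy {T ν : ℝ} (hν : 0 ≤ ν)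
    {u₀ : EuclideanSpace ℝ (Fin 3) → EuclideanSpace ℝ (Fin 3)}
    {u : ℝ → EuclideanSpace ℝ (Fin 3) → EuclideanSpace ℝ (Fin 3)}
    (h : IsLerayHopfOn T ν 0 u₀ u) {t : ℝ} (ht : t ∈ Icc 0 T) :
    ∫⁻ x, ‖u t x‖ₑ ^ 2 ≤ ENNReal.ofReal (2 * VectorCalculus.kineticEnergy u₀) :=
  IsLerayHopfOn.lintegral_enorm_sq_le hν h ht

/-! ### The regular flow -/

set_option maxHeartbeats 3200000 in
/-- **The regular flow from a bounded datum small in `L³_uloc`** (Lemarié-Rieusset 2016,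
Thm. 14.8, proof, Step 2, PDF pp. 521–525: the small solution `α₁ ∈ ∩_{T<T*} L^∞((0,T), E³)` with
`sup_t √t ‖α₁‖_∞` small, which "may be computed as well through Picard iterates in
`L^∞_t L²_uloc ∩ (L²_t H¹)_uloc`", so that it is a local Leray solution; Thm. 15.1 (A)). There are
`ε₀ > 0`, `K` and `C_g` such that: for every `A > 0`, `0 < ε ≤ ε₀` and every measurable, weakly
divergence-free `α ∈ L² ∩ L³` bounded by `A` with `‖α‖_{L³(B(z,1))} ≤ ε` for all `z`, there are a
velocity `a` and pressures `π`, `p_K` with: `(a, p_K)` a local Leray solution on `(0,2) × ℝ³` with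
datum `α` and `p_K ∈ L^{3/2}((0,2) × ℝ³)`; `(a, π)` a classical solution of the unit-viscosity
unforced equations on `(0, 4)`; `|a| ≤ M` and `√t|∇a| ≤ C` on `(0,4) × ℝ³` (constants depending on
the datum); `∫|a(t)|² ≤ 2E(α)`, `‖a(t)‖_{L³(B(z,1))} ≤ Kε`, `|a(t,x)| ≤ Kε t^{-1/2}` for
`0 < t < 4`; and the uniform local gradient bound `∫₀²∫_{B(x₀,1)} |∇a|² ≤ C_g` for every `x₀`.
[cite: LemarieRieusset2016, Thm. 14.8 proof Step 2 (PDF pp. 521–525); Thm. 15.1 (A)] [cite: JiaSverak2014, Lemma 3.1] -/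
theorem exists_uloc_regular_flow :
    ∃ ε₀ : ℝ, 0 < ε₀ ∧ ∃ K : ℝ, 0 < K ∧ ∃ Cg : ℝ≥0,
      ∀ {A ε : ℝ}, 0 < A → 0 < ε → ε ≤ ε₀ →
      ∀ {α : EuclideanSpace ℝ (Fin 3) → EuclideanSpace ℝ (Fin 3)},
        AEStronglyMeasurable α volume → (∀ x, ‖α x‖ ≤ A) → MemLp α 3 volume → MemLp α 2 volume →
        IsWeaklyDivFree α →
        (∀ z : EuclideanSpace ℝ (Fin 3), eLpNorm α 3 (volume.restrict (ball z 1)) ≤ ENNReal.ofReal ε) →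
        ∃ (a : ℝ → EuclideanSpace ℝ (Fin 3) → EuclideanSpace ℝ (Fin 3))
          (π pK : ℝ → EuclideanSpace ℝ (Fin 3) → ℝ),
          IsLocalLeraySolutionOn 2 1 α a pK ∧
          (∫⁻ z in Ioo 0 2 ×ˢ (univ : Set (EuclideanSpace ℝ (Fin 3))), ‖pK z.1 z.2‖ₑ ^ (3 / 2 : ℝ) < ⊤) ∧
          IsClassicalNSSolutionOn (Ioo 0 4) 1 0 a π ∧
          (∃ M : ℝ, 0 < M ∧ ∀ t ∈ Ioo 0 4, ∀ x, ‖a t x‖ ≤ M) ∧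
          (∃ C : ℝ, 0 ≤ C ∧ ∀ t ∈ Ioo 0 4, ∀ x, Real.sqrt t * ‖fderiv ℝ (a t) x‖ ≤ C) ∧
          (∀ t ∈ Ioo 0 4, ∫⁻ x, ‖a t x‖ₑ ^ 2 ≤ ENNReal.ofReal (2 * VectorCalculus.kineticEnergy α)) ∧
          (∀ t ∈ Ioo 0 4, ∀ z : EuclideanSpace ℝ (Fin 3),
            eLpNorm (a t) 3 (volume.restrict (ball z 1)) ≤ ENNReal.ofReal (K * ε)) ∧
          (∀ t ∈ Ioo 0 4, ∀ x, ‖a t x‖ ≤ K * ε * t ^ (-(1 / 2 : ℝ))) ∧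
          (∀ x₀ : EuclideanSpace ℝ (Fin 3),
            ∫⁻ z in Ioo 0 2 ×ˢ ball x₀ 1, ENNReal.ofReal (frobeniusNormSq (fderiv ℝ (a z.1) z.2)) ≤ Cg) := by
  have hS4 : (0 : ℝ) < 4 := by norm_num
  obtain ⟨ε₀, hε₀, K, hK, hB⟩ := exists_isKatoSolutionOn_uloc_small hS4
  obtain ⟨εJ, hεJ0, -, CJ, hJS⟩ := JiaSverak2014.apriori_unit_scale_slab
  -- ## the constants of the window argument
  set V : ℝ≥0∞ := volume (ball (0 : EuclideanSpace ℝ (Fin 3)) 1) with hV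
  have hVtop : V ≠ ⊤ := measure_ball_lt_top.ne
  have hV3top : V ^ (1 / 3 : ℝ) ≠ ⊤ := ENNReal.rpow_ne_top_of_nonneg (by norm_num) hVtop
  set K' : ℝ := max K 1 with hK'
  have hK'1 : 1 ≤ K' := le_max_right _ _
  have hKK' : K ≤ K' := le_max_left _ _
  have hK'0 : 0 < K' := by positivity
  -- `αJ ≥ |B₁|^{1/3} (K' ε₀)²`: a bound for the unit-ball energies of all restart data
  set αE : ℝ≥0∞ := V ^ (1 / 3 : ℝ) * ENNReal.ofReal ((K' * ε₀) ^ 2) with hαE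
  have hαEtop : αE ≠ ⊤ := ENNReal.mul_ne_top hV3top ENNReal.ofReal_ne_top
  set αJ : ℝ≥0 := αE.toNNReal with hαJ
  have hαJE : (αJ : ℝ≥0∞) = αE := ENNReal.coe_toNNReal hαEtop
  -- the window length `τ` and the number of windows
  set τ : ℝ := min (1 / 2) (min (εJ : ℝ) ((εJ : ℝ) / ((αJ : ℝ) ^ 2 + 1))) with hτ
  have hεJ0' : (0 : ℝ) < εJ := hεJ0
  have hτ0 : 0 < τ := by rw [hτ]; positivity
  have hτhalf : τ ≤ 1 / 2 := min_le_left _ _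
  have hτεJ : τ ≤ εJ := (min_le_right _ _).trans (min_le_left _ _)
  have hτα : τ * (αJ : ℝ) ^ 2 ≤ εJ := by
    have h1 : τ ≤ (εJ : ℝ) / ((αJ : ℝ) ^ 2 + 1) := (min_le_right _ _).trans (min_le_right _ _)
    have hpos : (0 : ℝ) < (αJ : ℝ) ^ 2 + 1 := by positivity
    calc τ * (αJ : ℝ) ^ 2 ≤ (εJ : ℝ) / ((αJ : ℝ) ^ 2 + 1) * ((αJ : ℝ) ^ 2 + 1) :=
          mul_le_mul h1 (by linarith) (by positivity) (by positivity)
      _ = (εJ : ℝ) := div_mul_cancel₀ _ hpos.ne'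
  set N : ℕ := ⌈4 / τ⌉₊ with hN
  set Cg : ℝ≥0 := ((N : ℝ≥0) + 1) * (CJ * αJ) with hCg
  refine ⟨ε₀, hε₀, K, hK, Cg, ?_⟩
  intro A ε hA hε hεε₀ α hαm hαA hα3 hα2 hdiv hαε
  obtain ⟨u, hkato, hu0, ⟨M, hM0, hubd⟩, hu8, huN, huinf, -, hfix⟩ := hB hA hε hεε₀ hαm hαA hα3 hdiv hαε
  have hν : (0 : ℝ) < 1 := one_pos
  ------------------------------------------------------------------
  -- ## Step 1: smoothness of `u` on `(0,4)` (KNSS)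
  ------------------------------------------------------------------
  set M₁ : ℝ := max M A with hM₁
  have hM₁0 : 0 ≤ M₁ := hM0.trans (le_max_left _ _)
  have hα8 : eLpNorm α ∞ volume ≤ ENNReal.ofReal M₁ := by
    rw [eLpNorm_exponent_top]
    exact eLpNormEssSup_le_of_ae_bound (Eventually.of_forall fun x => (hαA x).trans (le_max_right _ _))
  have hu8' : ∀ t ∈ Ioo (0 : ℝ) 4, eLpNorm (u t) ∞ volume ≤ ENNReal.ofReal M₁ := fun t ht => by
    rw [eLpNorm_exponent_top]
    exact eLpNormEssSup_le_of_ae_bound (Eventually.of_forall fun x => (hubd t ht x).trans (le_max_left _ _))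
  set ut : ℝ → EuclideanSpace ℝ (Fin 3) → EuclideanSpace ℝ (Fin 3) := fun t x =>
    UnboundedOperators.heatExtension α (1 * (t - 0)) x - oseenDuhamel 1 0 u u t x with hut
  have hfix' : ∀ t ∈ Ioo (0 : ℝ) 4, ∀ x, u t x = ut t x := fun t ht x => by
    simp only [hut, sub_zero, one_mul]; exact hfix t ht x
  have hOseen : ∀ t ∈ Ioo (0 : ℝ) 4, u t =ᵐ[volume] fun x =>
      UnboundedOperators.heatExtension α (1 * (t - 0)) x - oseenDuhamel 1 0 u u t x := fun t ht =>
    Eventually.of_forall fun x => hfix' t ht x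
  obtain ⟨hsmooth, -, hwt⟩ := knss2009_smoothing_holds (EuclideanSpace ℝ (Fin 3)) hν
    (by norm_num : (0 : ℝ) < 4) hM₁0 hαm hα8 hkato.aestronglyMeasurable hu8' hOseen
  have hut_slice : ∀ t ∈ Ioo (0 : ℝ) 4, u t = ut t := fun t ht => funext fun x => hfix' t ht x
  have hucont : ∀ t ∈ Ioo (0 : ℝ) 4, Continuous (u t) := fun t ht => by
    rw [hut_slice t ht]
    exact (hsmooth.contDiff_slice ht).continuous
  ------------------------------------------------------------------
  -- ## Step 2: the classical representative `a = u` on `(0,4)`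
  ------------------------------------------------------------------
  obtain ⟨a, π, hcl, hau⟩ := mild_L3_smooth_holds hν hS4 hα3 hdiv hkato.mild hkato.continuousInLpOn
    hkato.aestronglyMeasurable
  have haeq : ∀ t ∈ Ioo (0 : ℝ) 4, a t = u t := fun t ht =>
    ((hcl.contDiff_velocity ht).continuous.ae_eq_iff_eq volume (hucont t ht)).1 (hau t ht)
  have hcont : ContinuousOn (uncurry a) (Ioo 0 4 ×ˢ (univ : Set (EuclideanSpace ℝ (Fin 3)))) :=
    hcl.smooth_velocity.continuousOn
  ------------------------------------------------------------------
  -- ## Step 3: the local Leray structure on `(0,2)` with the global `L^{3/2}` pressure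
  ------------------------------------------------------------------
  have h24 : (2 : ℝ) < 4 := by norm_num
  obtain ⟨pK, hsuit, hpK⟩ := hkato.exists_suitable_slab_of_distributional kato_distributional_slab_holds
    hν two_pos h24
  obtain ⟨G, hG, hGb⟩ := hkato.uniformLocalGradient_of_suitable hν h24 hsuit hpK
  have hLKu : IsLocalLeraySolutionOn 2 1 α u pK := by
    refine ⟨hsuit, hkato.sqIntegrable_slab h24, fun Kc _ => ?_, fun R _ => hkato.uniformLocalEnergy_slab h24 R,
      ⟨G, hG, hGb⟩, fun Kc hKc => ?_, fun R _ => hkato.decay_slab h24 R⟩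
    · exact (lintegral_mono_set (Set.prod_mono Subset.rfl (subset_univ _))).trans_lt hpK
    · exact hkato.initial_slab hS4 Kc hKc
  have ham2 : AEStronglyMeasurable (uncurry a) (volume.restrict (Ioo 0 2 ×ˢ (univ : Set (EuclideanSpace ℝ (Fin 3))))) :=
    (hcont.mono (Set.prod_mono (Ioo_subset_Ioo_right h24.le) Subset.rfl)).aestronglyMeasurable
      (measurableSet_Ioo.prod MeasurableSet.univ)
  have hLK : IsLocalLeraySolutionOn 2 1 α a pK :=
    JiaSverak2014.isLocalLeraySolutionOn_congr_slices two_pos hLKu ham2 fun t ht =>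
      Eventually.of_forall fun x => by rw [haeq t ⟨ht.1, ht.2.trans h24⟩]
  ------------------------------------------------------------------
  -- ## Step 4: the bounds transferred to `a`
  ------------------------------------------------------------------
  have hbdM : ∀ t ∈ Ioo (0 : ℝ) 4, ∀ x, ‖a t x‖ ≤ M₁ + 1 := fun t ht x => by
    rw [haeq t ht]; exact (hubd t ht x).trans ((le_max_left _ _).trans (le_add_of_nonneg_right zero_le_one))
  -- gradient bound (KNSS, `k = 1`, `l = 0`)
  obtain ⟨C₁, hC₁⟩ := hwt 1 0
  have hgrad : ∀ t ∈ Ioo (0 : ℝ) 4, ∀ x, Real.sqrt t * ‖fderiv ℝ (a t) x‖ ≤ max C₁ 0 := by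
    intro t ht x
    have hg := hC₁ t ht x
    have hat : a t = ut t := (haeq t ht).trans (hut_slice t ht)
    rw [hat, ← norm_iteratedFDeriv_zero (𝕜 := ℝ) (f := fderiv ℝ (ut t)) (x := x), norm_iteratedFDeriv_fderiv,
      Real.sqrt_eq_rpow]
    simp only [hut, sub_zero, one_mul, Nat.cast_one, Nat.cast_zero, add_zero, iteratedDeriv_zero] at hg ⊢
    exact hg.trans (le_max_left _ _)
  -- energy: `u` is Leray–Hopf on `[0, T]` for every `T < 4`
  have hinfK : ∀ t ∈ Ioo (0 : ℝ) 4, eLpNorm (u t) ∞ volume ≤ ENNReal.ofReal (K * ε / Real.sqrt t) := by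
    intro t ht
    have h := huinf t ht
    rwa [Real.rpow_neg ht.1.le, ← Real.sqrt_eq_rpow, ← div_eq_mul_inv] at h
  have henergy : ∀ t ∈ Ioo (0 : ℝ) 4, ∫⁻ x, ‖a t x‖ₑ ^ 2 ≤ ENNReal.ofReal (2 * VectorCalculus.kineticEnergy α) := by
    intro t ht
    -- Leray–Hopf on `[0, (t + 4)/2]`
    have hT : (t + 4) / 2 < 4 := by linarith [ht.2]
    have hT0 : 0 < (t + 4) / 2 := by linarith [ht.1]
    obtain ⟨hLH, -⟩ := hkato.isLerayHopfOn_of_memLp_two hν hα2 hinfK hT hT0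
    have h := IsLerayHopfOn.lintegral_enorm_sq_le zero_le_one hLH (t := t) ⟨ht.1.le, by linarith [ht.2]⟩
    simpa only [haeq t ht] using h
  have hN3 : ∀ t ∈ Ioo (0 : ℝ) 4, ∀ z : EuclideanSpace ℝ (Fin 3),
      eLpNorm (a t) 3 (volume.restrict (ball z 1)) ≤ ENNReal.ofReal (K * ε) := fun t ht z => by
    rw [haeq t ht]; exact huN t ht z
  have hdecay : ∀ t ∈ Ioo (0 : ℝ) 4, ∀ x, ‖a t x‖ ≤ K * ε * t ^ (-(1 / 2 : ℝ)) := fun t ht x => by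
    rw [haeq t ht]; exact hu8 t ht x
  ------------------------------------------------------------------
  -- ## Step 5: the uniform local gradient bound by windows
  ------------------------------------------------------------------
  -- unit-ball energies of the restart data `u s`, `s ∈ [0, 4)`
  have hKε : K * ε ≤ K' * ε₀ := mul_le_mul hKK' hεε₀ hε.le hK'0.le
  have hdat : ∀ s ∈ Ico (0 : ℝ) 4, ∀ x₀ : EuclideanSpace ℝ (Fin 3),
      ∫⁻ x in ball x₀ 1, ‖u s x‖ₑ ^ 2 ≤ 2 * (αJ : ℝ≥0∞) := by
    intro s hs x₀
    have hsm : AEStronglyMeasurable (u s) volume := (hkato.memLp hs).1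
    have h3 : eLpNorm (u s) 3 (volume.restrict (ball x₀ 1)) ≤ ENNReal.ofReal (K' * ε₀) := by
      rcases eq_or_lt_of_le hs.1 with h0 | hpos
      · rw [← h0, hu0]
        exact (hαε x₀).trans (ENNReal.ofReal_le_ofReal (by nlinarith [hεε₀, hK'1, hε.le, hε₀.le]))
      · exact (huN s ⟨hpos, hs.2⟩ x₀).trans (ENNReal.ofReal_le_ofReal hKε)
    calc ∫⁻ x in ball x₀ 1, ‖u s x‖ₑ ^ 2 ≤ V ^ (1 / 3 : ℝ) * eLpNorm (u s) 3 (volume.restrict (ball x₀ 1)) ^ 2 :=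
          lintegral_unitBall_sq_le_eLpNorm_three_ball hsm x₀
      _ ≤ V ^ (1 / 3 : ℝ) * ENNReal.ofReal (K' * ε₀) ^ 2 := by gcongr
      _ = αE := by rw [hαE, ENNReal.ofReal_pow (by positivity)]
      _ = (αJ : ℝ≥0∞) := hαJE.symm
      _ ≤ 2 * (αJ : ℝ≥0∞) := le_mul_of_one_le_left' one_le_two
  -- one window: for `s ∈ [0, 5/2]`, `∫_{(s,s+τ)×B(x₀,1)} |∇a|² ≤ CJ αJ`
  have hwindow : ∀ s : ℝ, 0 ≤ s → s ≤ 5 / 2 → ∀ x₀ : EuclideanSpace ℝ (Fin 3),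
      ∫⁻ z in Ioo s (s + τ) ×ˢ ball x₀ 1, ENNReal.ofReal (frobeniusNormSq (fderiv ℝ (a z.1) z.2)) ≤
        ((CJ * αJ : ℝ≥0) : ℝ≥0∞) := by
    intro s hs0 hs52 x₀
    have hs4 : s < 4 := by linarith
    have hsI : s ∈ Ico (0 : ℝ) 4 := ⟨hs0, hs4⟩
    -- the restarted Kato solution and its local Leray structure on `(0, 1/2)`
    have hres : IsKatoSolutionOn (4 - s) 1 (u s) (fun t => u (s + t)) := hkato.restart hν hsI
    have hhalf : (1 / 2 : ℝ) < 4 - s := by linarith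
    obtain ⟨ps, hLs⟩ := kato_isLocalLeraySolutionOn_holds 1 (4 - s) (u s) (fun t => u (s + t)) hν hres (1 / 2)
      (by norm_num) hhalf
    -- the classical gradient of the shifted flow is a weak spatial gradient of the restart
    set as : ℝ → EuclideanSpace ℝ (Fin 3) → EuclideanSpace ℝ (Fin 3) := fun t x => a (s + t) x with has
    have hmaps : MapsTo (fun z : ℝ × EuclideanSpace ℝ (Fin 3) => (s + z.1, z.2))
        (Ioo (0 : ℝ) (1 / 2) ×ˢ (univ : Set (EuclideanSpace ℝ (Fin 3))))
        (Ioo (0 : ℝ) 4 ×ˢ (univ : Set (EuclideanSpace ℝ (Fin 3)))) := by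
      intro z hz
      exact ⟨⟨by linarith [hz.1.1], by linarith [hz.1.2]⟩, mem_univ _⟩
    have hshift : ContDiff ℝ ∞ (fun z : ℝ × EuclideanSpace ℝ (Fin 3) => ((s + z.1, z.2) : ℝ × EuclideanSpace ℝ (Fin 3))) :=
      (contDiff_const.add contDiff_fst).prodMk contDiff_snd
    have hasC : ContDiffOn ℝ 1 (uncurry as) (Ioo (0 : ℝ) (1 / 2) ×ˢ (univ : Set (EuclideanSpace ℝ (Fin 3)))) := by
      have h := (hcl.smooth_velocity.comp hshift.contDiffOn hmaps).of_le (m := 1) (by exact_mod_cast le_top)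
      refine h.congr fun z _ => ?_
      simp only [has, uncurry, comp_apply]
    have hQ : ((slab (EuclideanSpace ℝ (Fin 3)) (Ioo (0 : ℝ) (1 / 2)) isOpen_Ioo : Opens (ℝ × EuclideanSpace ℝ (Fin 3))) :
        Set (ℝ × EuclideanSpace ℝ (Fin 3))) ⊆ Ioo (0 : ℝ) (1 / 2) ×ˢ (univ : Set (EuclideanSpace ℝ (Fin 3))) := by
      rw [coe_slab]
    have hGa : HasWeakSpatialGradientOn (slab (EuclideanSpace ℝ (Fin 3)) (Ioo (0 : ℝ) (1 / 2)) isOpen_Ioo) as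
        fun t x => fderiv ℝ (as t) x :=
      hasWeakSpatialGradientOn_of_contDiffOn isOpen_Ioo hQ hasC
    have hGs : HasWeakSpatialGradientOn (slab (EuclideanSpace ℝ (Fin 3)) (Ioo (0 : ℝ) (1 / 2)) isOpen_Ioo)
        (fun t => u (s + t)) fun t x => fderiv ℝ (as t) x := by
      refine hGa.congr_ae ?_
      filter_upwards [ae_restrict_mem (by rw [coe_slab]; exact measurableSet_Ioo.prod MeasurableSet.univ)] with z hz
      rw [coe_slab] at hz
      have hz1 : s + z.1 ∈ Ioo (0 : ℝ) 4 := ⟨by linarith [hz.1.1], by linarith [hz.1.2]⟩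
      simp only [uncurry, has]
      rw [haeq (s + z.1) hz1]
    -- Jia–Šverák's a priori estimate on the window `(0, τ)`
    have hsm : AEStronglyMeasurable (u s) volume := (hkato.memLp hsI).1
    obtain ⟨-, hgradwin, -⟩ := hJS (u s) (fun t => u (s + t)) ps (fun t x => fderiv ℝ (as t) x) αJ (1 / 2) τ
      hsm hLs hGs (hdat s hsI) hτ0 hτhalf hτεJ hτα
    have h := hgradwin x₀
    -- back to `a` by the translation `t ↦ s + t`
    have e : ∫⁻ z in Ioo s (s + τ) ×ˢ ball x₀ 1, ENNReal.ofReal (frobeniusNormSq (fderiv ℝ (a z.1) z.2)) =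
        ∫⁻ z in Ioo 0 τ ×ˢ ball x₀ 1, ENNReal.ofReal (frobeniusNormSq (fderiv ℝ (as z.1) z.2)) := by
      have h' := setLIntegral_prod_comp_add_left (μ := (volume : Measure (EuclideanSpace ℝ (Fin 3)))) s τ (ball x₀ 1)
        (fun z : ℝ × EuclideanSpace ℝ (Fin 3) => ENNReal.ofReal (frobeniusNormSq (fderiv ℝ (a z.1) z.2)))
      exact h'
    rw [e]
    exact h
  -- summing the windows
  refine ⟨a, π, pK, hLK, hpK, hcl, ⟨M₁ + 1, by positivity, hbdM⟩, ⟨max C₁ 0, le_max_right _ _, hgrad⟩,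
    henergy, hN3, hdecay, fun x₀ => ?_⟩
  set F : ℝ × EuclideanSpace ℝ (Fin 3) → ℝ≥0∞ := fun z => ENNReal.ofReal (frobeniusNormSq (fderiv ℝ (a z.1) z.2)) with hF
  have hcover : Ioo (0 : ℝ) 2 ×ˢ ball x₀ 1 ⊆
      ⋃ m ∈ Finset.range (N + 1), Ioo ((m : ℝ) * τ / 2) ((m : ℝ) * τ / 2 + τ) ×ˢ ball x₀ 1 := by
    intro z hz
    obtain ⟨m, hm, hzm⟩ := mem_iUnion₂.1 (Ioo_subset_biUnion_windows hτ0 hz.1)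
    exact mem_iUnion₂.2 ⟨m, hm, ⟨hzm, hz.2⟩⟩
  calc ∫⁻ z in Ioo 0 2 ×ˢ ball x₀ 1, F z
      ≤ ∫⁻ z in ⋃ m ∈ Finset.range (N + 1), Ioo ((m : ℝ) * τ / 2) ((m : ℝ) * τ / 2 + τ) ×ˢ ball x₀ 1, F z :=
        lintegral_mono_set hcover
    _ ≤ (Finset.range (N + 1)).card * ((CJ * αJ : ℝ≥0) : ℝ≥0∞) := by
        refine lintegral_biUnion_finset_le_card_mul _ _ _ fun m hm => ?_
        have hm' : m ≤ N := Nat.lt_succ_iff.1 (Finset.mem_range.1 hm)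
        have hs0 : (0 : ℝ) ≤ (m : ℝ) * τ / 2 := by positivity
        have hs52 : (m : ℝ) * τ / 2 ≤ 5 / 2 := by
          -- `m τ/2 ≤ N τ/2 ≤ (4/τ + 1) τ/2 = 2 + τ/2 ≤ 9/4`
          have hNle : (N : ℝ) ≤ 4 / τ + 1 := by
            have := Nat.ceil_lt_add_one (by positivity : (0 : ℝ) ≤ 4 / τ)
            rw [← hN] at this; exact this.le
          have hmN : (m : ℝ) ≤ N := by exact_mod_cast hm'
          calc (m : ℝ) * τ / 2 ≤ (4 / τ + 1) * τ / 2 := by gcongr; exact hmN.trans hNle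
            _ = 2 + τ / 2 := by field_simp; ring
            _ ≤ 5 / 2 := by linarith
        have h := hwindow ((m : ℝ) * τ / 2) hs0 hs52 x₀
        exact h
    _ = Cg := by
        rw [Finset.card_range, hCg]
        push_cast
        ring

end Literature.Analysis.FluidPDE
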